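import Literature.NumberTheory.Automorphic.LocalHermitianFormSign   -- ★ `formSignAt`, `formSignAt_of_subsingleton`, `formSignAt_of_not_subsingleton`
import HarnessLib

/-!
# R90-TF · S3 wave 4 (J-S3-3), BRICK G7: THE LOCAL FORM SIGN `ε_v(H′)` IS INVARIANT UNDER A GROUND-FIELD CHANGE
# (`Theorems/R90S3TransportFormSignAt.lean` — pays `stub_R90_S3_transport_formSignAt` BY NAME, outright)

Cell `hodgecm-mathlib`, crux H413 (`stmt-HodgeConjecture-24833`), route of record `HCCMUnconditional`; programme R90-TF, section S3 (base `R90-C12`), wave 4 «LOCAL TRANSPORT»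
(S3-R12; dealer R90-C12-plan (g2) 23:19:08Z «G6 THEN G7 → K2E4-p14 (g11)»; socket `stub_R90_S3_transport_formSignAt` of `Cruxes/H413/Lines/R90_S3_LocalTransportWaveG.lean`
(tree 7af8ed512a325101 :519), binders and conclusion VERBATIM below).  Lane `--supports stmt-HodgeConjecture-24833 --as helper`; THEOREMS ONLY (no definition, no instance, no
notation, no `sorry`); ★-only imports; ns `…R90.S3`.  Pay line (G ED. 2): `stub_R90_S3_transport_formSignAt ‹binders› := formSignAt_transport ‹same›`.

THE MATHEMATICS [Rogawski1990 §14.6 p. 242; §3.5 Prop. 3.5.2 (c) p. 29].  ★ `formSignAt L c H′ v` is `+1` if `v` splits in `L` (two places over `v`), else the unit-norm test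
«`−det H′ ⊗ 1 = z · c̄(z)` for a unit `z` of `R_v = L ⊗ L⁺_v`», else `−1`.  Along the S3 currency `Φ : R_v ≃+* R′_{v′}` intertwining the conjugations (`hΦσ`) and carrying
`H′ ⊗ 1` to `H″ ⊗ 1` (`hΦH`): (i) NON-SPLITNESS TRANSPORTS — `v` is non-split iff `R_v = Π_{w∣v} L_w` has ONE factor iff `R_v` is a FIELD (a product of two fields has the
zero-divisor `(1, 0)`), and being a field is invariant under `Φ` (Mathlib `MulEquiv.isField`); (ii) the UNIT-NORM TEST TRANSPORTS — `Φ(det(H′ ⊗ 1)) = det(H″ ⊗ 1)` (Mathlib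
`RingHom.map_det` + `hΦH`), `Φ(z · c̄ z) = Φ z · c̄′(Φ z)` (`hΦσ`), units go to units; and back along `Φ⁻¹`.
* §1 `isField_localRing_iff_subsingleton_placesOver` (generic CM `E∕F`-free: any number field `E`, place `v` of `F`), `subsingleton_placesOver_transport_iff`;
  §2 `algebraMap_det_transport`, `exists_unit_norm_transport_iff`; §3 HEAD **`formSignAt_transport`** = the socket's statement.
HONEST LABEL: local algebra, no print input; HC_CM is proved only modulo the 7 printed citations (2 remaining named inputs: hLiu418 = stmt-HodgeConjecture-24832, h413 =
stmt-HodgeConjecture-24833) until rung 0 closes; count-neutral helper.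

## References
* [Rogawski1990] J. D. Rogawski, *Automorphic Representations of Unitary Groups in Three Variables*, Ann. of Math. Stud. 123 (1990), §14.6 p. 242 (`c_v`); §3.5 Prop. 3.5.2 (c) p. 29.
* [Jacobowitz1962] R. Jacobowitz, *Hermitian forms over local fields*, Amer. J. Math. 84 (1962), §3 Thm. 3.1.
-/

set_option autoImplicit false
-- the mandated namespace repeats the single-problem summit's segment (`HodgeConjecture.HodgeConjecture`)
set_option linter.dupNamespace false

noncomputable section

open IsDedekindDomain NumberField
open Literature.NumberTheory Literature.NumberTheory.Automorphic Literature.NumberTheory.Automorphic.UnitaryGroup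
open scoped Matrix

namespace Summit.HodgeConjecture.HodgeConjecture.R90.S3

/-! ## §1 Non-splitness is «`R_v` is a field», hence transports -/

section Field

variable {F : Type} (E : Type) [Field F] [NumberField F] [Field E] [NumberField E] [Algebra F E] (v : HeightOneSpectrum (𝓞 F))

/-- **`R_v = Π_{w ∣ v} E_w` is a field iff there is exactly one place of `E` over `v`** (there is always at least one): with one factor `R_v ≅ E_w` is a field; with two
distinct factors `w₁ ≠ w₂` the idempotent supported at `w₁` is a zero divisor. [cite: Rogawski1990, §14.6 p. 242] -/
theorem isField_localRing_iff_subsingleton_placesOver : IsField (LocalRing E v) ↔ Subsingleton (PlacesOver E v) := by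
  classical
  constructor
  · intro hF
    by_contra hns
    rw [not_subsingleton_iff_nontrivial] at hns
    obtain ⟨w₁, w₂, hne⟩ := hns
    letI := hF.toField
    have h1 : (Pi.single w₁ 1 : LocalRing E v) ≠ 0 := fun h => by simpa using congr_fun h w₁
    have h2 : (Pi.single w₂ 1 : LocalRing E v) ≠ 0 := fun h => by simpa using congr_fun h w₂
    have h12 : (Pi.single w₁ 1 : LocalRing E v) * Pi.single w₂ 1 = 0 := by
      funext w
      rcases eq_or_ne w w₁ with rfl | hw
      · simp [Pi.mul_apply, Pi.single_eq_of_ne hne]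
      · simp [Pi.mul_apply, Pi.single_eq_of_ne hw]
    exact (mul_ne_zero h1 h2) h12
  · intro hs
    obtain ⟨w⟩ : Nonempty (PlacesOver E v) := inferInstance
    letI : Unique (PlacesOver E v) := ⟨⟨w⟩, fun x => Subsingleton.elim x w⟩
    exact MulEquiv.isField (Field.toIsField _) (RingEquiv.piUnique fun w : PlacesOver E v => w.1.adicCompletion E).toMulEquiv

end Field

variable (L : Type) [Field L] [NumberField L] [IsCMField L] (H' : Matrix (Fin 3) (Fin 3) L)
  (v : HeightOneSpectrum (𝓞 ↥(maximalRealSubfield L)))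

omit [IsCMField L] in
/-- **Non-splitness transports along `Φ : R_v ≃+* R′_{v′}`** (both sides = «the local ring is a field», `isField_localRing_iff_subsingleton_placesOver` + Mathlib `MulEquiv.isField`).
[cite: Rogawski1990, §14.6 p. 242] -/
theorem subsingleton_placesOver_transport_iff
    (L' : Type) [Field L'] [NumberField L'] [IsCMField L'] (v' : HeightOneSpectrum (𝓞 ↥(maximalRealSubfield L')))
    (Φ : UnitaryGroup.LocalRing L v ≃+* UnitaryGroup.LocalRing L' v') :
    Subsingleton (PlacesOver L v) ↔ Subsingleton (PlacesOver L' v') := by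
  rw [← isField_localRing_iff_subsingleton_placesOver, ← isField_localRing_iff_subsingleton_placesOver]
  exact ⟨fun h => MulEquiv.isField h Φ.symm.toMulEquiv, fun h => MulEquiv.isField h Φ.toMulEquiv⟩

/-! ## §2 The unit-norm test transports -/

omit [IsCMField L] in
/-- `Φ(−det H′ ⊗ 1) = −det H″ ⊗ 1` under the exact form pair `hΦH` (Mathlib `RingHom.map_det`). [cite: Rogawski1990, §14.6 p. 242] -/
theorem algebraMap_neg_det_transport
    (L' : Type) [Field L'] [NumberField L'] [IsCMField L'] (v' : HeightOneSpectrum (𝓞 ↥(maximalRealSubfield L')))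
    (Φ : UnitaryGroup.LocalRing L v ≃+* UnitaryGroup.LocalRing L' v') (H'' : Matrix (Fin 3) (Fin 3) L')
    (hΦH : (H'.map (algebraMap L (UnitaryGroup.LocalRing L v))).map Φ = H''.map (algebraMap L' (UnitaryGroup.LocalRing L' v'))) :
    Φ (algebraMap L (UnitaryGroup.LocalRing L v) (-H'.det)) = algebraMap L' (UnitaryGroup.LocalRing L' v') (-H''.det) := by
  have h1 : algebraMap L (UnitaryGroup.LocalRing L v) H'.det = (H'.map (algebraMap L (UnitaryGroup.LocalRing L v))).det :=
    (algebraMap L (UnitaryGroup.LocalRing L v)).map_det H'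
  have h2 : algebraMap L' (UnitaryGroup.LocalRing L' v') H''.det = (H''.map (algebraMap L' (UnitaryGroup.LocalRing L' v'))).det :=
    (algebraMap L' (UnitaryGroup.LocalRing L' v')).map_det H''
  have h3 : Φ ((H'.map (algebraMap L (UnitaryGroup.LocalRing L v))).det) = ((H'.map (algebraMap L (UnitaryGroup.LocalRing L v))).map Φ).det :=
    (Φ : UnitaryGroup.LocalRing L v →+* UnitaryGroup.LocalRing L' v').map_det _
  simp only [map_neg]
  rw [h1, h2, h3, hΦH]

/-- **The unit-norm test «`−det H ⊗ 1 = z · c̄(z)`, `z` a unit» transports along `Φ`** (`hΦσ` intertwines the conjugations, `hΦH` carries the determinant, units map to units; back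
along `Φ⁻¹`). [cite: Rogawski1990, §3.5 Prop. 3.5.2 (c) p. 29; §14.6 p. 242] -/
theorem exists_unit_norm_transport_iff
    (L' : Type) [Field L'] [NumberField L'] [IsCMField L'] (v' : HeightOneSpectrum (𝓞 ↥(maximalRealSubfield L')))
    (Φ : UnitaryGroup.LocalRing L v ≃+* UnitaryGroup.LocalRing L' v')
    (hΦσ : ∀ x, Φ ((conjLocal L (IsCMField.complexConj L) v) x) = (conjLocal L' (IsCMField.complexConj L') v') (Φ x))
    (H'' : Matrix (Fin 3) (Fin 3) L')
    (hΦH : (H'.map (algebraMap L (UnitaryGroup.LocalRing L v))).map Φ = H''.map (algebraMap L' (UnitaryGroup.LocalRing L' v'))) :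
    (∃ z : UnitaryGroup.LocalRing L v, IsUnit z ∧ algebraMap L (UnitaryGroup.LocalRing L v) (-H'.det) = z * conjLocal L (IsCMField.complexConj L) v z) ↔
      (∃ z : UnitaryGroup.LocalRing L' v', IsUnit z ∧ algebraMap L' (UnitaryGroup.LocalRing L' v') (-H''.det) = z * conjLocal L' (IsCMField.complexConj L') v' z) := by
  have hdet := algebraMap_neg_det_transport L H' v L' v' Φ H'' hΦH
  constructor
  · rintro ⟨z, hz, h⟩
    refine ⟨Φ z, hz.map Φ, ?_⟩
    rw [← hdet, h, map_mul, hΦσ]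
  · rintro ⟨z', hz', h'⟩
    refine ⟨Φ.symm z', hz'.map Φ.symm, ?_⟩
    apply Φ.injective
    rw [hdet, h', map_mul, hΦσ, RingEquiv.apply_symm_apply]

/-! ## §3 The socket's bytes -/

/-- **BRICK G7 — THE LOCAL FORM SIGN TRANSPORTS** (socket `stub_R90_S3_transport_formSignAt`, binders and conclusion VERBATIM; `hc hc′` are dead for this purely algebraic statement and
carry `_` names): `formSignAt L′ c′ H″ v′ = formSignAt L c H′ v`. [cite: Rogawski1990, §14.6 p. 242; §3.5 Prop. 3.5.2 (c) p. 29] [cite: Jacobowitz1962, §3 Thm. 3.1] -/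
theorem formSignAt_transport
    (L' : Type) [Field L'] [NumberField L'] [IsCMField L'] (v' : HeightOneSpectrum (𝓞 ↥(maximalRealSubfield L')))
    (Φ : UnitaryGroup.LocalRing L v ≃+* UnitaryGroup.LocalRing L' v') (_hc : Continuous Φ) (_hc' : Continuous Φ.symm)
    (hΦσ : ∀ x, Φ ((conjLocal L (IsCMField.complexConj L) v) x) = (conjLocal L' (IsCMField.complexConj L') v') (Φ x))
    (H'' : Matrix (Fin 3) (Fin 3) L')
    (hΦH : (H'.map (algebraMap L (UnitaryGroup.LocalRing L v))).map Φ = H''.map (algebraMap L' (UnitaryGroup.LocalRing L' v')))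
    :
    formSignAt L' (IsCMField.complexConj L') H'' v' = formSignAt L (IsCMField.complexConj L) H' v := by
  classical
  by_cases hv : Subsingleton (PlacesOver L v)
  · have hv' : Subsingleton (PlacesOver L' v') := (subsingleton_placesOver_transport_iff L v L' v' Φ).1 hv
    rw [formSignAt_of_subsingleton L (IsCMField.complexConj L) H' v hv, formSignAt_of_subsingleton L' (IsCMField.complexConj L') H'' v' hv']
    exact if_congr (exists_unit_norm_transport_iff L H' v L' v' Φ hΦσ H'' hΦH).symm rfl rfl
  · have hv' : ¬ Subsingleton (PlacesOver L' v') := fun h => hv ((subsingleton_placesOver_transport_iff L v L' v' Φ).2 h)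
    rw [formSignAt_of_not_subsingleton L (IsCMField.complexConj L) H' v hv, formSignAt_of_not_subsingleton L' (IsCMField.complexConj L') H'' v' hv']

end Summit.HodgeConjecture.HodgeConjecture.R90.S3

end
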